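import Literature.NumberTheory.Automorphic.AdeleQuotientFejerLimit
import Literature.NumberTheory.Automorphic.AdelicPiSchwartzBruhatDensity
import Literature.NumberTheory.Automorphic.AdelicSecondCountable
import Literature.MeasureTheory.RieszRepresentation.PositiveFunctionalExtension
import HarnessLib

/-!
# Fibre measures of positive functionals on `𝒮(𝔸_F^ι)` along a map `h`; Weil's `E_X = Σ_b μ_b`

Topic `NumberTheory/Weil1965`; namespace `Literature.NumberTheory.Weil1965`. KERNEL MATHEMATICS ONLY:
no `def … : Prop` records, no `axiom`, no `sorry`; every `[cite: …]` tag is provenance for a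
kernel-checked statement; the one analytic input (Weil's condition (B)) is an explicit HYPOTHESIS `hB`.

Setting [Weil1965, Chap. IV n° 41, (34)–(35), pp. 58–59, at rank one]. `F` a number field,
`X = 𝔸_F^ι`, `h : X → 𝔸_F` continuous (in the application the adelic points of a quadratic /
hermitian form), `𝒮(X) = piSchwartzBruhat F ι`, `𝒮_ℝ(X) = piSchwartzBruhatReal F ι` its real
functions. A POSITIVE linear functional `S` on `𝒮_ℝ(X)` "is" a positive Radon measure `ν_S`
(Weil, Chap. I n° 2, Lemme 3; the tree's `RieszRepresentation/PositiveFunctionalExtension` through the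
sandwich property `piSchwartzBruhatReal_sandwich` of `Automorphic/AdelicPiSchwartzBruhatDensity`), and
its FIBRE MEASURES along `h` are `μ_b = ν_S|_{h⁻¹(b)}`, `b ∈ F`. This is typed ONCE (§2) for every
positive `S` — it serves Weil's Eisenstein-side `E_X` (§3) and the theta-side functional alike.

* §1 `adelicSiegelCoeff μ h Φ ξ = F*_Φ(ξ) = ∫_X ψ(ξ h(x)) Φ(x) dμ` and, under condition (B)
  `hB : ∀ Φ ∈ 𝒮(X), Σ_ξ |F*_Φ(ξ)| < ∞`, Weil's functional `adelicSiegelFunctional = E_X`,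
  `E_X(Ψ) = Σ_{ξ ∈ F} F*_Ψ(ξ)` on `𝒮_ℝ(X)` [Weil1965, (34)]: POSITIVE (`adelicSiegelFunctional_nonneg`,
  by the Fejér / Poisson argument on the compact quotient `𝔸_F ⧸ F`, tree `AdeleQuotientFejerLimit` =
  [Weil1965, Chap. I Lemmes 1–3, Prop. 1]) and invariant under `μ`-preserving homeomorphisms `T` with
  `h ∘ T = h` (`adelicSiegelCoeff_comp`, `adelicSiegelFunctional_comp`).
* §2 GENERIC, for any positive `S : 𝒮_ℝ(X) →ₗ[ℝ] ℝ`: `schwartzBruhatMeasure S hS = ν_S` (regular;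
  sandwich bounds `S Ψ₁ ≤ ∫ g dν_S ≤ S Ψ₂`; `∫ Ψ dν_S ≤ S Ψ` for `0 ≤ Ψ ∈ 𝒮_ℝ`; `|∫ Ψ dν_S| ≤ S Θ`;
  `∫ Ψ dν_S = S Ψ` under the tightness clause = Weil's "uniformément sur toute partie compacte de
  `𝒮(X)`"; invariance transfer `map_schwartzBruhatMeasure_eq`); `fibreMeasure S hS h b = μ_b`
  (carried by `h⁻¹(b)`, `∫ g(h x) Ψ dμ_b = g(b) ∫ Ψ dμ_b`, invariance transfer `map_fibreMeasure_eq`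
  for `T` with `h ∘ T = h`); and the SUPPORT TRANSFER: if `S` kills every `Ψ` supported in a compact
  set on which `h mod F ≠ 0`, then `ν_S {h mod F ≠ 0} = 0`, `Measure.sum μ_b = ν_S`
  (`sum_fibreMeasure`) and `∫ Ψ dν_S = Σ_b ∫ Ψ dμ_b`.
* §3 THE EISENSTEIN INSTANCE: `E_X` kills functions supported away from `h⁻¹(F)`
  (`adelicSiegelFunctional_eq_zero_of_tsupport_subset`, tree
  `tsum_integral_adeleQuotChar_comp_mul_eq_zero_of_forall_notMem`), hence
  `adelicSiegelMeasure = E_X` as a measure and `adelicSiegelFibreMeasure b = μ_b` with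
  **`Measure.sum μ_b = E_X`** [Weil1965, (35): "`μ_b` est une mesure positive tempérée sur `X_A`, de
  support contenu dans `i_X⁻¹({i})`", `E_X = Σ μ_b`], `∫ Ψ dE_X = Σ_b ∫ Ψ dμ_b`, `∫ Ψ dE_X ≤ E_X(Ψ)`,
  and invariance of `E_X` and of every `μ_b` under `μ`-preserving `T` with `h ∘ T = h` stabilising
  `𝒮(X)` [Weil1965, n° 46 p. 66].

What is NOT here: condition (B) itself for a given `h` (local Gauss-sum bounds and the height zeta
function — tree `LocalQuadraticGaussUnramified`, `AdelicHeightSumAffineLine`), the tightness supply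
(uniformity of (B) on compact subsets of `𝒮(X)`), and the Siegel–Weil comparison with the theta side.

## References

* A. Weil, *Sur la formule de Siegel dans la théorie des groupes classiques*, Acta Math. 113 (1965):
  Chap. I n° 2 Lemmes 2–3 p. 7, Prop. 1–2 pp. 8–12; Chap. IV n° 41 (33)–(35) pp. 58–59, n° 46 p. 66
  [Weil1965].
* W. Rudin, *Real and Complex Analysis* (1987), Thm. 2.14 [Rudin1987].
-/

noncomputable section

open MeasureTheory NumberField IsDedekindDomain Filter Topology Set CompactlySupported
  Literature.NumberTheory.Automorphic Literature.MeasureTheory.RieszRepresentation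
open scoped Classical

namespace Literature.NumberTheory.Weil1965

variable (F : Type) [Field F] [NumberField F] (ι : Type) [Fintype ι]
  [MeasurableSpace (adeleQuotient F)] [BorelSpace (adeleQuotient F)]
  [MeasurableSpace (AdeleRing (𝓞 F) F)] [BorelSpace (AdeleRing (𝓞 F) F)]

/-! ### Instances on `X = 𝔸_F^ι` (theorems of the tree, bound locally) -/

omit [MeasurableSpace (adeleQuotient F)] [BorelSpace (adeleQuotient F)]
  [MeasurableSpace (AdeleRing (𝓞 F) F)] [BorelSpace (AdeleRing (𝓞 F) F)] in
/-- `𝔸_F` is Hausdorff. [folklore] -/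
private theorem t2Space_adele : T2Space (AdeleRing (𝓞 F) F) := by
  haveI : T2Space (FiniteAdeleRing (𝓞 F) F) := inferInstanceAs <| T2Space
    (RestrictedProduct (fun w : IsDedekindDomain.HeightOneSpectrum (𝓞 F) => w.adicCompletion F)
      (fun w => (w.adicCompletionIntegers F : Set (w.adicCompletion F))) Filter.cofinite)
  haveI : T2Space (InfiniteAdeleRing F) :=
    inferInstanceAs <| T2Space ((w : InfinitePlace F) → w.Completion)
  exact inferInstanceAs <| T2Space (InfiniteAdeleRing F × FiniteAdeleRing (𝓞 F) F)

omit [MeasurableSpace (adeleQuotient F)] [BorelSpace (adeleQuotient F)]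
  [BorelSpace (AdeleRing (𝓞 F) F)] in
/-- `𝔸_F^ι` carries the Borel σ-algebra (product of second countable Borel factors). [folklore] -/
private theorem borelSpace_pi [BorelSpace (AdeleRing (𝓞 F) F)] :
    BorelSpace (ι → AdeleRing (𝓞 F) F) := by
  haveI := secondCountableTopology_adeleRing (K := F)
  infer_instance

omit [MeasurableSpace (adeleQuotient F)] [BorelSpace (adeleQuotient F)]
  [MeasurableSpace (AdeleRing (𝓞 F) F)] [BorelSpace (AdeleRing (𝓞 F) F)] in
/-- `𝔸_F^ι` is σ-compact (second countable and locally compact). [folklore] -/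
private theorem sigmaCompactSpace_pi : SigmaCompactSpace (ι → AdeleRing (𝓞 F) F) := by
  haveI := secondCountableTopology_adeleRing (K := F)
  haveI := locallyCompactSpace_adeleRing' (K := F)
  infer_instance

/-! ### §1 The coefficients `F*_Φ(ξ)` and the functional `E_X` -/

section Functional

variable (μ : Measure (ι → AdeleRing (𝓞 F) F)) (h : (ι → AdeleRing (𝓞 F) F) → AdeleRing (𝓞 F) F)

/-- **`F*_Φ(ξ) = ∫_X ψ(ξ · h(x)) Φ(x) dμ(x)`**, `ξ ∈ F` — the Fourier coefficient at `ξ` of the image of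
`Φ dμ` under `h` followed by `𝔸_F → 𝔸_F ⧸ F` (`ψ_ξ(u) = ψ(ξ u)` the characters of the compact quotient,
`adeleQuotChar`). [cite: Weil1965, Chap. IV n° 41, p. 59] -/
def adelicSiegelCoeff (Φ : (ι → AdeleRing (𝓞 F) F) → ℂ) (ξ : F) : ℂ :=
  ∫ x, (adeleQuotChar F ξ (QuotientAddGroup.mk (h x) : adeleQuotient F) : ℂ) * Φ x ∂μ

variable {F ι μ h}

omit [Fintype ι] [MeasurableSpace (adeleQuotient F)] [BorelSpace (adeleQuotient F)]
  [BorelSpace (AdeleRing (𝓞 F) F)] in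
/-- Unfolding `adelicSiegelCoeff`: `F*_Φ(ξ) = ∫ ψ(ξ h(x)) Φ(x) dμ`. [cite: Weil1965, Chap. IV n° 41, p. 59] -/
theorem adelicSiegelCoeff_eq (Φ : (ι → AdeleRing (𝓞 F) F) → ℂ) (ξ : F) :
    adelicSiegelCoeff F ι μ h Φ ξ =
      ∫ x, (adeleAddChar F (algebraMap F (AdeleRing (𝓞 F) F) ξ * h x) : ℂ) * Φ x ∂μ := by
  simp only [adelicSiegelCoeff, adeleQuotChar_mk]

omit [MeasurableSpace (adeleQuotient F)] [BorelSpace (adeleQuotient F)] in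
/-- `F*` is additive in `Φ` (integrable `Φ`). [cite: Weil1965, Chap. IV n° 41, p. 59] -/
theorem adelicSiegelCoeff_add {Φ₁ Φ₂ : (ι → AdeleRing (𝓞 F) F) → ℂ} (hh : Continuous h)
    (h₁ : Integrable Φ₁ μ) (h₂ : Integrable Φ₂ μ) (ξ : F) :
    adelicSiegelCoeff F ι μ h (Φ₁ + Φ₂) ξ =
      adelicSiegelCoeff F ι μ h Φ₁ ξ + adelicSiegelCoeff F ι μ h Φ₂ ξ := by
  haveI := borelSpace_pi F ι
  have hχ : Continuous fun x => (adeleQuotChar F ξ (QuotientAddGroup.mk (h x) : adeleQuotient F) : ℂ) :=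
    (continuous_adeleQuotChar F ξ).comp ((QuotientAddGroup.continuous_mk).comp hh)
  have hb : ∀ x, ‖(adeleQuotChar F ξ (QuotientAddGroup.mk (h x) : adeleQuotient F) : ℂ)‖ ≤ 1 :=
    fun x => (norm_adeleQuotChar F ξ _).le
  have hi : ∀ {Φ : (ι → AdeleRing (𝓞 F) F) → ℂ}, Integrable Φ μ →
      Integrable (fun x => (adeleQuotChar F ξ (QuotientAddGroup.mk (h x) : adeleQuotient F) : ℂ) * Φ x) μ :=
    fun hΦ => hΦ.bdd_mul hχ.aestronglyMeasurable (ae_of_all _ hb)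
  simp only [adelicSiegelCoeff, Pi.add_apply, mul_add]
  exact integral_add (hi h₁) (hi h₂)

omit [Fintype ι] [MeasurableSpace (adeleQuotient F)] [BorelSpace (adeleQuotient F)]
  [BorelSpace (AdeleRing (𝓞 F) F)] in
/-- `F*` is homogeneous in `Φ`. [cite: Weil1965, Chap. IV n° 41, p. 59] -/
theorem adelicSiegelCoeff_smul (c : ℂ) (Φ : (ι → AdeleRing (𝓞 F) F) → ℂ) (ξ : F) :
    adelicSiegelCoeff F ι μ h (c • Φ) ξ = c * adelicSiegelCoeff F ι μ h Φ ξ := by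
  simp only [adelicSiegelCoeff, Pi.smul_apply, smul_eq_mul, ← integral_const_mul]
  exact integral_congr_ae (ae_of_all _ fun x => by ring)

omit [Fintype ι] [MeasurableSpace (adeleQuotient F)] [BorelSpace (adeleQuotient F)]
  [BorelSpace (AdeleRing (𝓞 F) F)] in
/-- **Invariance of the coefficients**: for a `μ`-preserving measurable `T : X → X` with `h ∘ T = h`,
`F*_{Φ ∘ T}(ξ) = F*_Φ(ξ)`. [cite: Weil1965, Chap. IV n° 46, p. 66] -/
theorem adelicSiegelCoeff_comp {T : (ι → AdeleRing (𝓞 F) F) → (ι → AdeleRing (𝓞 F) F)}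
    (hT : MeasurePreserving T μ μ) (hTe : MeasurableEmbedding T) (hTh : ∀ x, h (T x) = h x)
    (Φ : (ι → AdeleRing (𝓞 F) F) → ℂ) (ξ : F) :
    adelicSiegelCoeff F ι μ h (Φ ∘ T) ξ = adelicSiegelCoeff F ι μ h Φ ξ := by
  simp only [adelicSiegelCoeff, Function.comp_apply]
  calc ∫ x, (adeleQuotChar F ξ (QuotientAddGroup.mk (h x) : adeleQuotient F) : ℂ) * Φ (T x) ∂μ
      = ∫ x, (fun y => (adeleQuotChar F ξ (QuotientAddGroup.mk (h y) : adeleQuotient F) : ℂ) * Φ y)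
          (T x) ∂μ := integral_congr_ae (ae_of_all _ fun x => by simp only [hTh x])
    _ = ∫ y, (adeleQuotChar F ξ (QuotientAddGroup.mk (h y) : adeleQuotient F) : ℂ) * Φ y ∂μ :=
        hT.integral_comp hTe (fun y => (adeleQuotChar F ξ (QuotientAddGroup.mk (h y) : adeleQuotient F) : ℂ) * Φ y)

variable (F ι μ h)

/-- **Weil's Siegel–Eisenstein functional `E_X` on the real Schwartz–Bruhat functions**,
`E_X(Ψ) = Σ_{ξ ∈ F} F*_Ψ(ξ)` (real part; the sum is real, `adelicSiegelFunctional_im_eq_zero`), as an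
`ℝ`-linear functional `𝒮_ℝ(𝔸_F^ι) → ℝ` under Weil's condition (B) `hB` (absolute convergence of
`Σ_ξ F*_Φ(ξ)` on `𝒮(𝔸_F^ι)`). [cite: Weil1965, Chap. IV n° 41, (34) p. 59] -/
def adelicSiegelFunctional [μ.IsAddHaarMeasure] (hh : Continuous h)
    (hB : ∀ Φ ∈ piSchwartzBruhat F ι, Summable fun ξ : F => ‖adelicSiegelCoeff F ι μ h Φ ξ‖) :
    piSchwartzBruhatReal F ι →ₗ[ℝ] ℝ where
  toFun Ψ := (∑' ξ : F, adelicSiegelCoeff F ι μ h (fun x => ((Ψ : (ι → AdeleRing (𝓞 F) F) → ℝ) x : ℂ)) ξ).re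
  map_add' Ψ₁ Ψ₂ := by
    have h₁ := Ψ₁.2
    have h₂ := Ψ₂.2
    rw [mem_piSchwartzBruhatReal_iff] at h₁ h₂
    have heq : (fun x => (((Ψ₁ + Ψ₂ : piSchwartzBruhatReal F ι) : (ι → AdeleRing (𝓞 F) F) → ℝ) x : ℂ)) =
        (fun x => ((Ψ₁ : (ι → AdeleRing (𝓞 F) F) → ℝ) x : ℂ)) + fun x => ((Ψ₂ : (ι → AdeleRing (𝓞 F) F) → ℝ) x : ℂ) := by
      funext x
      simp only [Submodule.coe_add, Pi.add_apply, Complex.ofReal_add]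
    rw [heq, ← Complex.add_re, ← (hB _ h₁).of_norm.tsum_add (hB _ h₂).of_norm]
    congr 1
    exact tsum_congr fun ξ => adelicSiegelCoeff_add hh (integrable_of_mem_piSchwartzBruhat h₁)
      (integrable_of_mem_piSchwartzBruhat h₂) ξ
  map_smul' c Ψ := by
    have heq : (fun x => (((c • Ψ : piSchwartzBruhatReal F ι) : (ι → AdeleRing (𝓞 F) F) → ℝ) x : ℂ)) =
        (c : ℂ) • fun x => ((Ψ : (ι → AdeleRing (𝓞 F) F) → ℝ) x : ℂ) := by
      funext x
      simp only [Submodule.coe_smul, Pi.smul_apply, smul_eq_mul, Complex.ofReal_mul]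
    simp only [heq, adelicSiegelCoeff_smul, tsum_mul_left, RingHom.id_apply, smul_eq_mul,
      Complex.re_ofReal_mul]

variable {F ι μ h}

omit [MeasurableSpace (adeleQuotient F)] [BorelSpace (adeleQuotient F)] in
/-- Unfolding `adelicSiegelFunctional`. [cite: Weil1965, Chap. IV n° 41, (34) p. 59] -/
theorem adelicSiegelFunctional_apply [μ.IsAddHaarMeasure] (hh : Continuous h)
    (hB : ∀ Φ ∈ piSchwartzBruhat F ι, Summable fun ξ : F => ‖adelicSiegelCoeff F ι μ h Φ ξ‖)
    (Ψ : piSchwartzBruhatReal F ι) :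
    adelicSiegelFunctional F ι μ h hh hB Ψ =
      (∑' ξ : F, adelicSiegelCoeff F ι μ h (fun x => ((Ψ : (ι → AdeleRing (𝓞 F) F) → ℝ) x : ℂ)) ξ).re := rfl

/-- **Positivity of `E_X`** [Weil1965, Chap. I Lemme 3: "si `T` est une mesure positive, il en est de
même de `S`"]: `0 ≤ Ψ ∈ 𝒮_ℝ(X) ⇒ 0 ≤ E_X(Ψ)`, and the defining series is real
(tree `tsum_integral_adeleQuotChar_comp_mul_nonneg`, Fejér kernels on `𝔸_F ⧸ F`).
[cite: Weil1965, Chap. I n° 2, Lemme 3, p. 7] -/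
theorem adelicSiegelFunctional_nonneg [μ.IsAddHaarMeasure] (hh : Continuous h)
    (hB : ∀ Φ ∈ piSchwartzBruhat F ι, Summable fun ξ : F => ‖adelicSiegelCoeff F ι μ h Φ ξ‖)
    (Ψ : piSchwartzBruhatReal F ι) (hΨ : 0 ≤ (Ψ : (ι → AdeleRing (𝓞 F) F) → ℝ)) :
    0 ≤ adelicSiegelFunctional F ι μ h hh hB Ψ ∧
      (∑' ξ : F, adelicSiegelCoeff F ι μ h (fun x => ((Ψ : (ι → AdeleRing (𝓞 F) F) → ℝ) x : ℂ)) ξ).im = 0 := by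
  haveI := borelSpace_pi F ι
  obtain ⟨φ, hφc, hφ0, hφ1, hφs⟩ := exists_fejer_approximateUnit F
  have hf : Measurable fun x => (QuotientAddGroup.mk (h x) : adeleQuotient F) :=
    ((QuotientAddGroup.continuous_mk).comp hh).measurable
  have hΨm := Ψ.2
  rw [mem_piSchwartzBruhatReal_iff] at hΨm
  have hI : Integrable (Ψ : (ι → AdeleRing (𝓞 F) F) → ℝ) μ := by
    exact (integrable_of_mem_piSchwartzBruhat (ν := μ) hΨm).re.congr (ae_of_all _ fun x => by
      simp only [RCLike.re_to_complex, Complex.ofReal_re])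
  exact tsum_integral_adeleQuotChar_comp_mul_nonneg F μ φ hφc hφ0 hφ1 hφs hf hI hΨ (hB _ hΨm)

/-- **Sandwich property of `E_X`** (from `piSchwartzBruhatReal_sandwich`): the hypothesis `hL` of the
tree's `sandwichMeasure`. [cite: Weil1965, Chap. I n° 2, Lemme 3, p. 7] -/
theorem adelicSiegelFunctional_sandwich [μ.IsAddHaarMeasure] (hh : Continuous h)
    (hB : ∀ Φ ∈ piSchwartzBruhat F ι, Summable fun ξ : F => ‖adelicSiegelCoeff F ι μ h Φ ξ‖)
    (g : C_c(ι → AdeleRing (𝓞 F) F, ℝ)) (ε : ℝ) (hε : 0 < ε) :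
    ∃ Ψ₁ Ψ₂ : piSchwartzBruhatReal F ι,
      (Ψ₁ : (ι → AdeleRing (𝓞 F) F) → ℝ) ≤ g ∧ (g : (ι → AdeleRing (𝓞 F) F) → ℝ) ≤ Ψ₂ ∧
      adelicSiegelFunctional F ι μ h hh hB Ψ₂ ≤ adelicSiegelFunctional F ι μ h hh hB Ψ₁ + ε :=
  piSchwartzBruhatReal_sandwich _ (fun Ψ hΨ => (adelicSiegelFunctional_nonneg hh hB Ψ hΨ).1) g ε hε

omit [MeasurableSpace (adeleQuotient F)] [BorelSpace (adeleQuotient F)] in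
/-- **Invariance of `E_X`**: `E_X(Ψ ∘ T) = E_X(Ψ)` for a `μ`-preserving homeomorphism `T` with
`h ∘ T = h`. [cite: Weil1965, Chap. IV n° 46, p. 66] -/
theorem adelicSiegelFunctional_comp [μ.IsAddHaarMeasure] (hh : Continuous h)
    (hB : ∀ Φ ∈ piSchwartzBruhat F ι, Summable fun ξ : F => ‖adelicSiegelCoeff F ι μ h Φ ξ‖)
    (T : (ι → AdeleRing (𝓞 F) F) ≃ₜ (ι → AdeleRing (𝓞 F) F)) (hT : MeasurePreserving T μ μ)
    (hTh : ∀ x, h (T x) = h x) (Ψ : piSchwartzBruhatReal F ι)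
    (hΨT : (Ψ : (ι → AdeleRing (𝓞 F) F) → ℝ) ∘ T ∈ piSchwartzBruhatReal F ι) :
    adelicSiegelFunctional F ι μ h hh hB ⟨(Ψ : (ι → AdeleRing (𝓞 F) F) → ℝ) ∘ T, hΨT⟩ =
      adelicSiegelFunctional F ι μ h hh hB Ψ := by
  haveI := borelSpace_pi F ι
  simp only [adelicSiegelFunctional_apply]
  congr 1
  exact tsum_congr fun ξ =>
    adelicSiegelCoeff_comp hT T.measurableEmbedding hTh (fun x => ((Ψ : (ι → AdeleRing (𝓞 F) F) → ℝ) x : ℂ)) ξ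

end Functional

/-! ### §2 Radon measures of positive functionals on `𝒮_ℝ(𝔸_F^ι)` and their fibres along `h` -/

section Generic

variable (S : piSchwartzBruhatReal F ι →ₗ[ℝ] ℝ)
  (hS : ∀ Ψ : piSchwartzBruhatReal F ι, 0 ≤ (Ψ : (ι → AdeleRing (𝓞 F) F) → ℝ) → 0 ≤ S Ψ)

omit [MeasurableSpace (adeleQuotient F)] [BorelSpace (adeleQuotient F)]
  [MeasurableSpace (AdeleRing (𝓞 F) F)] [BorelSpace (AdeleRing (𝓞 F) F)] [Fintype ι] in
/-- `𝔸_F^ι` is Hausdorff. [folklore] -/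
private theorem t2Space_pi : T2Space (ι → AdeleRing (𝓞 F) F) := by
  haveI := t2Space_adele F
  infer_instance

omit [MeasurableSpace (adeleQuotient F)] [BorelSpace (adeleQuotient F)]
  [MeasurableSpace (AdeleRing (𝓞 F) F)] [BorelSpace (AdeleRing (𝓞 F) F)] in
/-- `𝔸_F^ι` is locally compact. [folklore] -/
private theorem locallyCompactSpace_pi : LocallyCompactSpace (ι → AdeleRing (𝓞 F) F) := by
  haveI := locallyCompactSpace_adeleRing' (K := F)
  infer_instance

/-- **The positive Radon measure of a positive linear functional `S` on `𝒮_ℝ(𝔸_F^ι)`** (tree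
`sandwichMeasure`, through the sandwich property `piSchwartzBruhatReal_sandwich` of the real
Schwartz–Bruhat functions): "une distribution (tempérée) positive est une mesure positive". Used for
Weil's `E_X` (below) and for its theta-side counterpart alike. [cite: Weil1965, Chap. I n° 2, Lemme 3, p. 7] -/
def schwartzBruhatMeasure : Measure (ι → AdeleRing (𝓞 F) F) := by
  haveI := borelSpace_pi F ι
  haveI := t2Space_pi F ι
  haveI := locallyCompactSpace_pi F ι
  exact sandwichMeasure hS (piSchwartzBruhatReal_sandwich S hS)

omit [MeasurableSpace (adeleQuotient F)] [BorelSpace (adeleQuotient F)] in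
/-- The measure of `S` is a regular Borel measure. [cite: Rudin1987, Ch. 2, Thm. 2.14 & Thm. 2.18] -/
theorem regular_schwartzBruhatMeasure : (schwartzBruhatMeasure F ι S hS).Regular := by
  haveI := borelSpace_pi F ι
  haveI := t2Space_pi F ι
  haveI := locallyCompactSpace_pi F ι
  exact regular_sandwichMeasure _ _

omit [MeasurableSpace (adeleQuotient F)] [BorelSpace (adeleQuotient F)] in
/-- **Sandwich bounds**: `Ψ₁ ≤ g` in `𝒮_ℝ(X)` gives `S Ψ₁ ≤ ∫ g dν_S` for a test function `g`.
[cite: Weil1965, Chap. I n° 2, Lemme 3, p. 7] -/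
theorem le_integral_schwartzBruhatMeasure (g : C_c(ι → AdeleRing (𝓞 F) F, ℝ))
    {Ψ₁ : piSchwartzBruhatReal F ι} (h₁ : (Ψ₁ : (ι → AdeleRing (𝓞 F) F) → ℝ) ≤ g) :
    S Ψ₁ ≤ ∫ x, g x ∂(schwartzBruhatMeasure F ι S hS) := by
  haveI := borelSpace_pi F ι
  haveI := t2Space_pi F ι
  haveI := locallyCompactSpace_pi F ι
  show _ ≤ ∫ x, g x ∂(sandwichMeasure _ _)
  rw [integral_sandwichMeasure]
  exact le_sandwichFunctional _ _ h₁

omit [MeasurableSpace (adeleQuotient F)] [BorelSpace (adeleQuotient F)] in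
/-- **Sandwich bounds**: `g ≤ Ψ₂` in `𝒮_ℝ(X)` gives `∫ g dν_S ≤ S Ψ₂` for a test function `g`.
[cite: Weil1965, Chap. I n° 2, Lemme 3, p. 7] -/
theorem integral_schwartzBruhatMeasure_le (g : C_c(ι → AdeleRing (𝓞 F) F, ℝ))
    {Ψ₂ : piSchwartzBruhatReal F ι} (h₂ : (g : (ι → AdeleRing (𝓞 F) F) → ℝ) ≤ Ψ₂) :
    ∫ x, g x ∂(schwartzBruhatMeasure F ι S hS) ≤ S Ψ₂ := by
  haveI := borelSpace_pi F ι
  haveI := t2Space_pi F ι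
  haveI := locallyCompactSpace_pi F ι
  show ∫ x, g x ∂(sandwichMeasure _ _) ≤ _
  rw [integral_sandwichMeasure]
  exact sandwichFunctional_le _ _ h₂

omit [MeasurableSpace (adeleQuotient F)] [BorelSpace (adeleQuotient F)] in
/-- A test function that is itself in `𝒮_ℝ(X)` (as `Ψ`) has `∫ Ψ dν_S = S Ψ`.
[cite: Weil1965, Chap. I n° 2, Lemme 3, p. 7] -/
theorem integral_schwartzBruhatMeasure_eq_of_coe_eq (g : C_c(ι → AdeleRing (𝓞 F) F, ℝ))
    {Ψ : piSchwartzBruhatReal F ι} (hg : (g : (ι → AdeleRing (𝓞 F) F) → ℝ) = Ψ) :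
    ∫ x, g x ∂(schwartzBruhatMeasure F ι S hS) = S Ψ :=
  le_antisymm (integral_schwartzBruhatMeasure_le F ι S hS g hg.le)
    (le_integral_schwartzBruhatMeasure F ι S hS g hg.ge)

omit [MeasurableSpace (adeleQuotient F)] [BorelSpace (adeleQuotient F)] in
/-- **`∫ Ψ dν_S ≤ S Ψ`** for every nonnegative `Ψ ∈ 𝒮_ℝ(X)` (which is `ν_S`-integrable).
[cite: Weil1965, Chap. I n° 2, Lemme 3, p. 7] -/
theorem integral_schwartzBruhatMeasure_le_of_nonneg (Ψ : piSchwartzBruhatReal F ι)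
    (hΨ : 0 ≤ (Ψ : (ι → AdeleRing (𝓞 F) F) → ℝ)) :
    Integrable (Ψ : (ι → AdeleRing (𝓞 F) F) → ℝ) (schwartzBruhatMeasure F ι S hS) ∧
      ∫ x, (Ψ : (ι → AdeleRing (𝓞 F) F) → ℝ) x ∂(schwartzBruhatMeasure F ι S hS) ≤ S Ψ := by
  haveI := borelSpace_pi F ι
  haveI := t2Space_pi F ι
  haveI := locallyCompactSpace_pi F ι
  haveI := sigmaCompactSpace_pi F ι
  have hc := continuous_of_mem_piSchwartzBruhatReal Ψ.2
  exact ⟨integrable_sandwichMeasure_of_mem _ _ Ψ hc hΨ, integral_sandwichMeasure_le_of_mem _ _ Ψ hc hΨ⟩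

omit [MeasurableSpace (adeleQuotient F)] [BorelSpace (adeleQuotient F)] in
/-- A `Ψ ∈ 𝒮_ℝ(X)` dominated by `Θ ∈ 𝒮_ℝ(X)` (`|Ψ| ≤ Θ`) is `ν_S`-integrable with `|∫ Ψ dν_S| ≤ S Θ`.
[cite: Weil1965, Chap. I n° 2, Lemme 3, p. 7] -/
theorem abs_integral_schwartzBruhatMeasure_le (Ψ Θ : piSchwartzBruhatReal F ι)
    (hle : ∀ x, |(Ψ : (ι → AdeleRing (𝓞 F) F) → ℝ) x| ≤ (Θ : (ι → AdeleRing (𝓞 F) F) → ℝ) x) :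
    Integrable (Ψ : (ι → AdeleRing (𝓞 F) F) → ℝ) (schwartzBruhatMeasure F ι S hS) ∧
      |∫ x, (Ψ : (ι → AdeleRing (𝓞 F) F) → ℝ) x ∂(schwartzBruhatMeasure F ι S hS)| ≤ S Θ := by
  haveI := borelSpace_pi F ι
  haveI := t2Space_pi F ι
  haveI := locallyCompactSpace_pi F ι
  haveI := sigmaCompactSpace_pi F ι
  exact integrable_sandwichMeasure_of_abs_le _ _ Ψ Θ (continuous_of_mem_piSchwartzBruhatReal Ψ.2)
    (continuous_of_mem_piSchwartzBruhatReal Θ.2) hle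

omit [MeasurableSpace (adeleQuotient F)] [BorelSpace (adeleQuotient F)] in
/-- **`∫ Ψ dν_S = S Ψ` under tightness**: if `Ψ ∈ 𝒮_ℝ(X)` is, for every `ε > 0`, within a
`Θ ∈ 𝒮_ℝ(X)` with `S Θ ≤ ε` of a compactly supported `Ψ' ∈ 𝒮_ℝ(X)`, then `∫ Ψ dν_S = S Ψ`
(Weil: a positive functional continuous on compact subsets of `𝒮(X)` is a *tempered* measure).
[cite: Weil1965, Chap. I n° 2, Lemme 2–3, p. 7] -/
theorem integral_schwartzBruhatMeasure_eq_of_tight (Ψ : piSchwartzBruhatReal F ι)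
    (ht : ∀ ε : ℝ, 0 < ε → ∃ Ψ' Θ : piSchwartzBruhatReal F ι,
      HasCompactSupport (Ψ' : (ι → AdeleRing (𝓞 F) F) → ℝ) ∧
      (∀ x, |(Ψ : (ι → AdeleRing (𝓞 F) F) → ℝ) x - (Ψ' : (ι → AdeleRing (𝓞 F) F) → ℝ) x| ≤
        (Θ : (ι → AdeleRing (𝓞 F) F) → ℝ) x) ∧ S Θ ≤ ε) :
    Integrable (Ψ : (ι → AdeleRing (𝓞 F) F) → ℝ) (schwartzBruhatMeasure F ι S hS) ∧
      ∫ x, (Ψ : (ι → AdeleRing (𝓞 F) F) → ℝ) x ∂(schwartzBruhatMeasure F ι S hS) = S Ψ := by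
  haveI := borelSpace_pi F ι
  haveI := t2Space_pi F ι
  haveI := locallyCompactSpace_pi F ι
  haveI := sigmaCompactSpace_pi F ι
  refine integral_sandwichMeasure_eq_of_mem _ _ Ψ (continuous_of_mem_piSchwartzBruhatReal Ψ.2)
    fun ε hε => ?_
  obtain ⟨Ψ', Θ, hc, hle, hΘ⟩ := ht ε hε
  exact ⟨Ψ', Θ, continuous_of_mem_piSchwartzBruhatReal Ψ'.2, hc,
    continuous_of_mem_piSchwartzBruhatReal Θ.2, hle, hΘ⟩

omit [MeasurableSpace (adeleQuotient F)] [BorelSpace (adeleQuotient F)] in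
/-- **Invariance transfer**: a homeomorphism `T` of `X` stabilising `𝒮(X)` with `S (Ψ ∘ T) = S Ψ`
preserves `ν_S`. [cite: Weil1965, Chap. IV n° 46, p. 66] -/
theorem map_schwartzBruhatMeasure_eq (T : (ι → AdeleRing (𝓞 F) F) ≃ₜ (ι → AdeleRing (𝓞 F) F))
    (hTS : ∀ Φ ∈ piSchwartzBruhat F ι, Φ ∘ T ∈ piSchwartzBruhat F ι)
    (hST : ∀ (Ψ : piSchwartzBruhatReal F ι)
      (hΨT : (Ψ : (ι → AdeleRing (𝓞 F) F) → ℝ) ∘ T ∈ piSchwartzBruhatReal F ι),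
      S ⟨(Ψ : (ι → AdeleRing (𝓞 F) F) → ℝ) ∘ T, hΨT⟩ = S Ψ) :
    (schwartzBruhatMeasure F ι S hS).map T = schwartzBruhatMeasure F ι S hS := by
  haveI := borelSpace_pi F ι
  haveI := t2Space_pi F ι
  haveI := locallyCompactSpace_pi F ι
  have hT' : ∀ Ψ : piSchwartzBruhatReal F ι,
      (Ψ : (ι → AdeleRing (𝓞 F) F) → ℝ) ∘ T ∈ piSchwartzBruhatReal F ι := fun Ψ => by
    rw [mem_piSchwartzBruhatReal_iff]
    exact hTS _ Ψ.2
  exact map_sandwichMeasure_eq _ _ T hT' fun Ψ => hST Ψ (hT' Ψ)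

variable (h : (ι → AdeleRing (𝓞 F) F) → AdeleRing (𝓞 F) F)

omit [MeasurableSpace (adeleQuotient F)] [BorelSpace (adeleQuotient F)] in
/-- **Support transfer**: if `S` kills every `Ψ ∈ 𝒮_ℝ(X)` supported in a compact set on which
`h(x) mod F ≠ 0`, then `ν_S` is carried by `h⁻¹(F)`: the open set `{x | h x mod F ≠ 0}` is
`ν_S`-null. [cite: Weil1965, Chap. IV n° 41, (35) p. 59] -/
theorem schwartzBruhatMeasure_apply_eq_zero (hh : Continuous h)
    (hS0 : ∀ (Ψ : piSchwartzBruhatReal F ι) (L : Set (ι → AdeleRing (𝓞 F) F)), IsCompact L →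
      (∀ x ∈ L, (QuotientAddGroup.mk (h x) : adeleQuotient F) ≠ 0) →
      tsupport (Ψ : (ι → AdeleRing (𝓞 F) F) → ℝ) ⊆ L → S Ψ = 0) :
    schwartzBruhatMeasure F ι S hS {x | (QuotientAddGroup.mk (h x) : adeleQuotient F) ≠ 0} = 0 := by
  haveI := borelSpace_pi F ι
  haveI := t2Space_pi F ι
  haveI := locallyCompactSpace_pi F ι
  have hfc : Continuous fun x : ι → AdeleRing (𝓞 F) F =>
      (QuotientAddGroup.mk (h x) : adeleQuotient F) :=
    (QuotientAddGroup.continuous_mk).comp hh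
  have hU : IsOpen {x : ι → AdeleRing (𝓞 F) F | (QuotientAddGroup.mk (h x) : adeleQuotient F) ≠ 0} :=
    isOpen_compl_singleton.preimage hfc
  refine sandwichMeasure_apply_eq_zero_of_forall _ _ hU fun g hg => ?_
  obtain ⟨L, hLc, hgL, hLU⟩ := exists_compact_between g.hasCompactSupport hU hg
  obtain ⟨Ψ₁, Ψ₂, h₁, h₂, -, -, -, -, -, hs₁, hs₂⟩ :=
    piSchwartzBruhatReal_sandwich_of_subset S hS g isOpen_interior hgL one_pos
  have hz₁ := hS0 Ψ₁ L hLc (fun x hx => hLU hx) (hs₁.trans interior_subset)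
  have hz₂ := hS0 Ψ₂ L hLc (fun x hx => hLU hx) (hs₂.trans interior_subset)
  exact le_antisymm ((sandwichFunctional_le _ _ h₂).trans_eq hz₂)
    (hz₁.symm.trans_le (le_sandwichFunctional _ _ h₁))

omit [MeasurableSpace (adeleQuotient F)] [BorelSpace (adeleQuotient F)] in
/-- Under the support hypothesis, `h x ∈ F ⊆ 𝔸_F` for `ν_S`-almost every `x`.
[cite: Weil1965, Chap. IV n° 41, (35) p. 59] -/
theorem ae_schwartzBruhatMeasure_mem_range (hh : Continuous h)
    (hS0 : ∀ (Ψ : piSchwartzBruhatReal F ι) (L : Set (ι → AdeleRing (𝓞 F) F)), IsCompact L →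
      (∀ x ∈ L, (QuotientAddGroup.mk (h x) : adeleQuotient F) ≠ 0) →
      tsupport (Ψ : (ι → AdeleRing (𝓞 F) F) → ℝ) ⊆ L → S Ψ = 0) :
    ∀ᵐ x ∂(schwartzBruhatMeasure F ι S hS), h x ∈ Set.range (algebraMap F (AdeleRing (𝓞 F) F)) := by
  rw [ae_iff]
  convert schwartzBruhatMeasure_apply_eq_zero F ι S hS h hh hS0 using 2
  ext x
  simp only [mem_setOf_eq, ne_eq, QuotientAddGroup.eq_zero_iff, Set.mem_range]
  exact Iff.rfl

/-- **The fibre measure `μ_b = ν_S|_{h⁻¹(b)}`** of a positive functional `S` on `𝒮_ℝ(X)` along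
`h : X → 𝔸_F` at `b ∈ F` — the common currency of Weil's `E_X = Σ_b μ_b` and of its theta-side
counterpart. [cite: Weil1965, Chap. IV n° 41, (35) p. 59] -/
def fibreMeasure (b : F) : Measure (ι → AdeleRing (𝓞 F) F) :=
  (schwartzBruhatMeasure F ι S hS).restrict (h ⁻¹' {algebraMap F (AdeleRing (𝓞 F) F) b})

omit [MeasurableSpace (adeleQuotient F)] [BorelSpace (adeleQuotient F)] in
/-- The fibres `h⁻¹(b)` are closed, hence measurable. [cite: Weil1965, Chap. IV n° 41, (35) p. 59] -/
theorem measurableSet_fibre (hh : Continuous h) (b : F) :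
    MeasurableSet (h ⁻¹' {algebraMap F (AdeleRing (𝓞 F) F) b}) := by
  haveI := borelSpace_pi F ι
  haveI := t2Space_adele F
  exact (isClosed_singleton.preimage hh).measurableSet

omit [MeasurableSpace (adeleQuotient F)] [BorelSpace (adeleQuotient F)] in
/-- `μ_b` is carried by the fibre: `μ_b (h⁻¹(b))ᶜ = 0`. [cite: Weil1965, Chap. IV n° 41, (35) p. 59] -/
theorem fibreMeasure_compl (hh : Continuous h) (b : F) :
    fibreMeasure F ι S hS h b (h ⁻¹' {algebraMap F (AdeleRing (𝓞 F) F) b})ᶜ = 0 := by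
  rw [fibreMeasure, Measure.restrict_apply (measurableSet_fibre F ι h hh b).compl,
    compl_inter_self, measure_empty]

omit [MeasurableSpace (adeleQuotient F)] [BorelSpace (adeleQuotient F)] in
/-- `μ_b ≤ ν_S`. [cite: Weil1965, Chap. IV n° 41, (35) p. 59] -/
theorem fibreMeasure_le (b : F) : fibreMeasure F ι S hS h b ≤ schwartzBruhatMeasure F ι S hS :=
  Measure.restrict_le_self

omit [MeasurableSpace (adeleQuotient F)] [BorelSpace (adeleQuotient F)] in
/-- **Functions of `h` are constant on the fibres**: `∫ g(h x) Ψ(x) dμ_b = g(b) ∫ Ψ dμ_b` — the Fourier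
structure `S(ψ(β h) Φ) = Σ_b ψ(β b) μ_b(Φ)` behind Weil's coefficient extraction.
[cite: Weil1965, Chap. IV n° 41, (35) p. 59] -/
theorem integral_fibreMeasure_comp_mul (hh : Continuous h) (b : F) (g : AdeleRing (𝓞 F) F → ℂ)
    (Ψ : (ι → AdeleRing (𝓞 F) F) → ℂ) :
    ∫ x, g (h x) * Ψ x ∂(fibreMeasure F ι S hS h b) =
      g (algebraMap F (AdeleRing (𝓞 F) F) b) * ∫ x, Ψ x ∂(fibreMeasure F ι S hS h b) := by
  rw [fibreMeasure, ← integral_const_mul]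
  refine setIntegral_congr_fun (measurableSet_fibre F ι h hh b) fun x hx => ?_
  rw [mem_preimage, mem_singleton_iff] at hx
  rw [hx]

omit [MeasurableSpace (adeleQuotient F)] [BorelSpace (adeleQuotient F)] in
/-- **`ν_S = Σ_{b ∈ F} μ_b`** under the support hypothesis (`ν_S` is carried by the disjoint union of
the fibres over `F`). [cite: Weil1965, Chap. IV n° 41, (35) p. 59] -/
theorem sum_fibreMeasure (hh : Continuous h)
    (hS0 : ∀ (Ψ : piSchwartzBruhatReal F ι) (L : Set (ι → AdeleRing (𝓞 F) F)), IsCompact L →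
      (∀ x ∈ L, (QuotientAddGroup.mk (h x) : adeleQuotient F) ≠ 0) →
      tsupport (Ψ : (ι → AdeleRing (𝓞 F) F) → ℝ) ⊆ L → S Ψ = 0) :
    Measure.sum (fun b : F => fibreMeasure F ι S hS h b) = schwartzBruhatMeasure F ι S hS := by
  haveI : Countable F := NumberField.countable' (K := F)
  have hdisj : Pairwise (Function.onFun Disjoint fun b : F => h ⁻¹' {algebraMap F (AdeleRing (𝓞 F) F) b}) :=
    fun b b' hne => Disjoint.preimage h (disjoint_singleton.mpr
      ((AdeleRing.algebraMap_injective (𝓞 F) F).ne hne))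
  simp only [fibreMeasure]
  rw [← Measure.restrict_iUnion hdisj (measurableSet_fibre F ι h hh)]
  refine Measure.restrict_eq_self_of_ae_mem ?_
  filter_upwards [ae_schwartzBruhatMeasure_mem_range F ι S hS h hh hS0] with x hx
  obtain ⟨b, hb⟩ := hx
  exact mem_iUnion.mpr ⟨b, hb.symm⟩

omit [MeasurableSpace (adeleQuotient F)] [BorelSpace (adeleQuotient F)] in
/-- **`∫ Ψ dν_S = Σ_b ∫ Ψ dμ_b`** for every `ν_S`-integrable `Ψ`, under the support hypothesis.
[cite: Weil1965, Chap. IV n° 41, (35) p. 59] -/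
theorem integral_schwartzBruhatMeasure_eq_tsum (hh : Continuous h)
    (hS0 : ∀ (Ψ : piSchwartzBruhatReal F ι) (L : Set (ι → AdeleRing (𝓞 F) F)), IsCompact L →
      (∀ x ∈ L, (QuotientAddGroup.mk (h x) : adeleQuotient F) ≠ 0) →
      tsupport (Ψ : (ι → AdeleRing (𝓞 F) F) → ℝ) ⊆ L → S Ψ = 0)
    {E : Type*} [NormedAddCommGroup E] [NormedSpace ℝ E]
    {Ψ : (ι → AdeleRing (𝓞 F) F) → E} (hΨ : Integrable Ψ (schwartzBruhatMeasure F ι S hS)) :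
    ∫ x, Ψ x ∂(schwartzBruhatMeasure F ι S hS) = ∑' b : F, ∫ x, Ψ x ∂(fibreMeasure F ι S hS h b) := by
  haveI : Countable F := NumberField.countable' (K := F)
  rw [← sum_fibreMeasure F ι S hS h hh hS0] at hΨ
  conv_lhs => rw [← sum_fibreMeasure F ι S hS h hh hS0]
  exact integral_sum_measure hΨ

omit [MeasurableSpace (adeleQuotient F)] [BorelSpace (adeleQuotient F)] in
/-- **Invariance transfer for the fibres**: a homeomorphism `T` of `X` with `h ∘ T = h`, stabilising
`𝒮(X)` and `S`, preserves every `μ_b`. [cite: Weil1965, Chap. IV n° 46, p. 66] -/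
theorem map_fibreMeasure_eq (T : (ι → AdeleRing (𝓞 F) F) ≃ₜ (ι → AdeleRing (𝓞 F) F))
    (hTh : ∀ x, h (T x) = h x) (hTS : ∀ Φ ∈ piSchwartzBruhat F ι, Φ ∘ T ∈ piSchwartzBruhat F ι)
    (hST : ∀ (Ψ : piSchwartzBruhatReal F ι)
      (hΨT : (Ψ : (ι → AdeleRing (𝓞 F) F) → ℝ) ∘ T ∈ piSchwartzBruhatReal F ι),
      S ⟨(Ψ : (ι → AdeleRing (𝓞 F) F) → ℝ) ∘ T, hΨT⟩ = S Ψ) (b : F) :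
    (fibreMeasure F ι S hS h b).map T = fibreMeasure F ι S hS h b := by
  haveI := borelSpace_pi F ι
  have hpre : T ⁻¹' (h ⁻¹' {algebraMap F (AdeleRing (𝓞 F) F) b}) =
      h ⁻¹' {algebraMap F (AdeleRing (𝓞 F) F) b} := by
    ext x
    simp only [mem_preimage, hTh x]
  rw [fibreMeasure, ← hpre, ← T.measurableEmbedding.restrict_map, hpre,
    map_schwartzBruhatMeasure_eq F ι S hS T hTS hST]

end Generic

/-! ### §3 Weil's measure `E_X` and its fibre measures `μ_b` -/

section Eisenstein

variable (μ : Measure (ι → AdeleRing (𝓞 F) F)) [μ.IsAddHaarMeasure]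
  (h : (ι → AdeleRing (𝓞 F) F) → AdeleRing (𝓞 F) F) (hh : Continuous h)
  (hB : ∀ Φ ∈ piSchwartzBruhat F ι, Summable fun ξ : F => ‖adelicSiegelCoeff F ι μ h Φ ξ‖)

/-- **`E_X` vanishes on functions supported away from `h⁻¹(F)`**: if `Ψ ∈ 𝒮_ℝ(X)` has
`tsupport Ψ ⊆ L`, `L` compact with `h(x) mod F ≠ 0` on `L`, then `E_X(Ψ) = 0` (tree
`tsum_integral_adeleQuotChar_comp_mul_eq_zero_of_forall_notMem` with the open neighbourhood
`(h(L) mod F)ᶜ` of `0`). [cite: Weil1965, Chap. I n° 2, Lemme 3, p. 7] -/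
theorem adelicSiegelFunctional_eq_zero_of_tsupport_subset (Ψ : piSchwartzBruhatReal F ι)
    (L : Set (ι → AdeleRing (𝓞 F) F)) (hL : IsCompact L)
    (hL0 : ∀ x ∈ L, (QuotientAddGroup.mk (h x) : adeleQuotient F) ≠ 0)
    (hΨL : tsupport (Ψ : (ι → AdeleRing (𝓞 F) F) → ℝ) ⊆ L) :
    adelicSiegelFunctional F ι μ h hh hB Ψ = 0 := by
  haveI := borelSpace_pi F ι
  have hfc : Continuous fun x : ι → AdeleRing (𝓞 F) F =>
      (QuotientAddGroup.mk (h x) : adeleQuotient F) :=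
    (QuotientAddGroup.continuous_mk).comp hh
  obtain ⟨φ, hφc, hφ0, hφ1, hφs⟩ := exists_fejer_approximateUnit F
  have hΨm := Ψ.2
  rw [mem_piSchwartzBruhatReal_iff] at hΨm
  -- the open neighbourhood `W = (f '' L)ᶜ` of `0`
  have hW : ((fun x : ι → AdeleRing (𝓞 F) F => (QuotientAddGroup.mk (h x) : adeleQuotient F)) '' L)ᶜ
      ∈ 𝓝 (0 : adeleQuotient F) := by
    refine (hL.image hfc).isClosed.isOpen_compl.mem_nhds fun h0 => ?_
    obtain ⟨x, hx, hx0⟩ := h0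
    exact hL0 x hx hx0
  have hzero := tsum_integral_adeleQuotChar_comp_mul_eq_zero_of_forall_notMem F μ φ hφc hφ0 hφ1
    hφs hfc.measurable (integrable_of_mem_piSchwartzBruhat (ν := μ) hΨm) (hB _ hΨm) hW
    (fun x hx hxW => hxW ⟨x, hΨL (subset_tsupport _ (by
      simpa only [Function.mem_support, ne_eq, Complex.ofReal_eq_zero] using hx)), rfl⟩)
  rw [adelicSiegelFunctional_apply]
  simp only [adelicSiegelCoeff] at hzero ⊢
  rw [hzero, Complex.zero_re]

/-- **Weil's Siegel–Eisenstein measure `ν₀ = E_X` on `X = 𝔸_F^ι`**: the positive Radon measure of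
the positive functional `E_X` on `𝒮_ℝ(X)`. [cite: Weil1965, Chap. IV n° 41, (35) p. 59] -/
def adelicSiegelMeasure : Measure (ι → AdeleRing (𝓞 F) F) :=
  schwartzBruhatMeasure F ι (adelicSiegelFunctional F ι μ h hh hB)
    (fun Ψ hΨ => (adelicSiegelFunctional_nonneg hh hB Ψ hΨ).1)

/-- **Weil's fibre measures `μ_b = E_X|_{h⁻¹(b)}`, `b ∈ F`** [Weil1965, (35): "`μ_b` est une mesure
positive tempérée sur `X_A`, de support contenu dans `i_X⁻¹({i})`"].
[cite: Weil1965, Chap. IV n° 41, (35) p. 59] -/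
def adelicSiegelFibreMeasure (b : F) : Measure (ι → AdeleRing (𝓞 F) F) :=
  fibreMeasure F ι (adelicSiegelFunctional F ι μ h hh hB)
    (fun Ψ hΨ => (adelicSiegelFunctional_nonneg hh hB Ψ hΨ).1) h b

variable {F ι μ h}

/-- `adelicSiegelFibreMeasure` is the restriction of `adelicSiegelMeasure` to the fibre (definitional).
[cite: Weil1965, Chap. IV n° 41, (35) p. 59] -/
theorem adelicSiegelFibreMeasure_eq (b : F) :
    adelicSiegelFibreMeasure F ι μ h hh hB b =
      (adelicSiegelMeasure F ι μ h hh hB).restrict (h ⁻¹' {algebraMap F (AdeleRing (𝓞 F) F) b}) :=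
  rfl

/-- **`E_X` is carried by `h⁻¹(F)`**: `E_X {x | h x mod F ≠ 0} = 0`.
[cite: Weil1965, Chap. IV n° 41, (35) p. 59] -/
theorem adelicSiegelMeasure_apply_eq_zero :
    adelicSiegelMeasure F ι μ h hh hB {x | (QuotientAddGroup.mk (h x) : adeleQuotient F) ≠ 0} = 0 :=
  schwartzBruhatMeasure_apply_eq_zero F ι _ _ h hh
    (adelicSiegelFunctional_eq_zero_of_tsupport_subset F ι μ h hh hB)

/-- **`E_X = Σ_{b ∈ F} μ_b`** as measures. [cite: Weil1965, Chap. IV n° 41, (35) p. 59] -/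
theorem sum_adelicSiegelFibreMeasure :
    Measure.sum (fun b : F => adelicSiegelFibreMeasure F ι μ h hh hB b) =
      adelicSiegelMeasure F ι μ h hh hB :=
  sum_fibreMeasure F ι _ _ h hh (adelicSiegelFunctional_eq_zero_of_tsupport_subset F ι μ h hh hB)

/-- **`∫ Ψ dE_X = Σ_b ∫ Ψ dμ_b`** for every `E_X`-integrable `Ψ`. [cite: Weil1965, Chap. IV n° 41, (35) p. 59] -/
theorem integral_adelicSiegelMeasure_eq_tsum {E : Type*} [NormedAddCommGroup E] [NormedSpace ℝ E]
    {Ψ : (ι → AdeleRing (𝓞 F) F) → E} (hΨ : Integrable Ψ (adelicSiegelMeasure F ι μ h hh hB)) :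
    ∫ x, Ψ x ∂(adelicSiegelMeasure F ι μ h hh hB) =
      ∑' b : F, ∫ x, Ψ x ∂(adelicSiegelFibreMeasure F ι μ h hh hB b) :=
  integral_schwartzBruhatMeasure_eq_tsum F ι _ _ h hh
    (adelicSiegelFunctional_eq_zero_of_tsupport_subset F ι μ h hh hB) hΨ

/-- **`∫ Ψ dE_X ≤ E_X(Ψ)`** for `0 ≤ Ψ ∈ 𝒮_ℝ(X)`. [cite: Weil1965, Chap. I n° 2, Lemme 3, p. 7] -/
theorem integral_adelicSiegelMeasure_le_of_nonneg (Ψ : piSchwartzBruhatReal F ι)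
    (hΨ : 0 ≤ (Ψ : (ι → AdeleRing (𝓞 F) F) → ℝ)) :
    Integrable (Ψ : (ι → AdeleRing (𝓞 F) F) → ℝ) (adelicSiegelMeasure F ι μ h hh hB) ∧
      ∫ x, (Ψ : (ι → AdeleRing (𝓞 F) F) → ℝ) x ∂(adelicSiegelMeasure F ι μ h hh hB) ≤
        adelicSiegelFunctional F ι μ h hh hB Ψ :=
  integral_schwartzBruhatMeasure_le_of_nonneg F ι _ _ Ψ hΨ

/-- **Invariance of `E_X` and of every `μ_b`** under a `μ`-preserving homeomorphism `T` of `X` with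
`h ∘ T = h` stabilising `𝒮(X)` [Weil1965, n° 46: the `μ_b` are invariant under the isometry group].
[cite: Weil1965, Chap. IV n° 46, p. 66] -/
theorem map_adelicSiegelFibreMeasure_eq (T : (ι → AdeleRing (𝓞 F) F) ≃ₜ (ι → AdeleRing (𝓞 F) F))
    (hT : MeasurePreserving T μ μ) (hTh : ∀ x, h (T x) = h x)
    (hTS : ∀ Φ ∈ piSchwartzBruhat F ι, Φ ∘ T ∈ piSchwartzBruhat F ι) (b : F) :
    (adelicSiegelMeasure F ι μ h hh hB).map T = adelicSiegelMeasure F ι μ h hh hB ∧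
      (adelicSiegelFibreMeasure F ι μ h hh hB b).map T = adelicSiegelFibreMeasure F ι μ h hh hB b :=
  ⟨map_schwartzBruhatMeasure_eq F ι _ _ T hTS
      fun Ψ hΨT => adelicSiegelFunctional_comp hh hB T hT hTh Ψ hΨT,
    map_fibreMeasure_eq F ι _ _ h T hTh hTS
      (fun Ψ hΨT => adelicSiegelFunctional_comp hh hB T hT hTh Ψ hΨT) b⟩

end Eisenstein

end Literature.NumberTheory.Weil1965
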